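import Summits.Langlands.Langlands.Theorems.NonParallelVoidTensorSquareParallelStubTensorInductionPDForm
import Summits.Langlands.Langlands.Theses.NonParallelVoid
import Literature.NumberTheory.GaloisRepresentations.AbsGaloisGroup
import Literature.NumberTheory.GaloisRepresentations.AbsGaloisOuterConj
import HarnessLib

/-!
# Stub `stub_tensorInductionExists` of line `merged` (v2) for crux `TensorSquareParallel`
# (stmt-Langlands-17009): tensor induction from an imaginary quadratic field, with the
# Kronecker shape of its restriction recorded

For `F/ℚ` imaginary quadratic and a framed `ρ : Γ_F →ₜ* GL₂(ℚ̄_p)` unramified almost everywhere, the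
tensor induction `ψ = ⊗-Ind_{Γ_F}^{Γ_ℚ} ρ : Γ_ℚ →ₜ* GL₄(ℚ̄_p)` (`tensorInduce`, helper file
`…StubTensorInductionPDConstruction`) satisfies the conjuncts

* (T0)  `tr ψ(res σ) = tr ρ(σ) · tr ρ(σ')` whenever `res σ' = τ res(σ) τ⁻¹` with `τ ∉ res(Γ_F)`;
* (T0') **new in v2**: there are `τ₀ ∈ Γ_ℚ ∖ res(Γ_F)`, a relabelling `e : Fin 2 × Fin 2 ≃ Fin 4` and a
  frame change `P ∈ GL₄` with `ψ(res σ) = P · e_*(ρ(σ) ⊗ₖ ρ(θ_{τ₀} σ)) · P⁻¹` for all `σ ∈ Γ_F`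
  (`θ_{τ₀} = absGaloisOuterConj ℚ F τ₀`), i.e. `ψ|_{Γ_F} ≅ ρ ⊗ ρ^{θ}` on the nose up to the frame;
  for `ψ = tensorInduce ℚ F h2 e ρ` this holds with `τ₀ = tiTau ℚ F h2`, `P = 1`
  (`tensorInduce_apply_coe`, `tiMatrixHom_absGaloisRestrict`);
* (T1)  `ψ` is unramified almost everywhere (`eventually_isUnramifiedAt_tensorInduce`);
* (T2)  `ψ` is `GO₄`-valued: `ψ(g)ᵀ J ψ(g) = μ(g) J` for the symmetric `J = tiForm e` with unit
  determinant and the multiplier `μ = tiMult`, and `μ(c) = 1` at complex conjugations;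
* (T5)  `tr ψ(c) = 2 ≠ 0` at complex conjugations.

(T0), (T1), (T2), (T5) are discharged by the very lemmas behind the landed
`stub_tensorInductionPD_exists` / `exists_tensorInduction` (helper file `…StubTensorInductionPDForm`).

References: F. Calegari, *Even Galois representations and the Fontaine–Mazur conjecture*, Invent.
Math. 185 (2011), §2; C. W. Curtis, I. Reiner, *Methods of Representation Theory* I, §13 (tensor
induction).
-/

noncomputable section

set_option linter.dupNamespace false  -- `Summit.Langlands.Langlands.…` is the mandated summit-side namespace (D-0022)

open scoped NumberField Kronecker
open IsDedekindDomain Field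
open Literature.NumberTheory.GaloisRepresentations

namespace Summit.Langlands.Langlands.Theorems.TensorSquareParallel

section Rat

variable (F : Type) [Field F] [NumberField F] [Algebra.IsQuadraticExtension ℚ F]

/-- **(T0') for `ψ = ⊗-Ind ρ`**: on `Γ_F` the tensor induction IS the relabelled Kronecker product
`ρ(σ) ⊗ₖ ρ(θ_τ σ)` with `τ = tiTau ℚ F h2` (frame change `P = 1`).
Ref: Curtis–Reiner, *Methods of representation theory* I, §13. [folklore] -/
theorem tensorInduce_absGaloisRestrict_val_eq_kronecker (h2 : Module.finrank ℚ F = 2) (p : ℕ) [Fact p.Prime]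
    (e : Fin 2 × Fin 2 ≃ Fin 4) (ρ : FramedGaloisRep F (PadicAlgCl p) 2) (σ : absoluteGaloisGroup F) :
    (tensorInduce ℚ F h2 e ρ (absGaloisRestrict ℚ F σ)).val =
      (1 : GL (Fin 4) (PadicAlgCl p)).val *
        Matrix.reindex e e ((ρ σ).val ⊗ₖ (ρ (absGaloisOuterConj ℚ F (tiTau ℚ F h2) σ)).val) *
        (1 : GL (Fin 4) (PadicAlgCl p))⁻¹.val := by
  rw [inv_one, Units.val_one, one_mul, mul_one, tensorInduce_apply_coe, tiMatrixHom_absGaloisRestrict]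

/-- **Tensor induction from an imaginary quadratic field to `ℚ` — the conjuncts (T0), (T0'), (T1),
(T2), (T5).**  For `F/ℚ` imaginary quadratic and a framed `ρ : Γ_F →ₜ* GL₂(ℚ̄_p)` unramified almost
everywhere, `ψ = ⊗-Ind_{Γ_F}^{Γ_ℚ} ρ` (`tensorInduce`) satisfies (T0) the trace identity on `Γ_F`,
(T0') `ψ(res σ) = P · e_*(ρ(σ) ⊗ₖ ρ(θ_{τ₀} σ)) · P⁻¹` for some `τ₀ ∉ res(Γ_F)`, `e`, `P` (here
`τ₀ = tiTau`, `P = 1`), (T1) unramified a.e., (T2) `GO₄`-valued with trivial multiplier at complex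
conjugations, (T5) `tr ψ(c) ≠ 0`.  Ref: F. Calegari, *Even Galois representations and the
Fontaine–Mazur conjecture*, §2; Curtis–Reiner, *Methods of representation theory* I, §13. [folklore] -/
theorem exists_tensorInduction_kronecker (hF : NumberField.IsTotallyComplex F) (p : ℕ) [Fact p.Prime]
    (ρ : FramedGaloisRep F (PadicAlgCl p) 2)
    (hunr : ∀ᶠ v : HeightOneSpectrum (𝓞 F) in Filter.cofinite, ρ.IsUnramifiedAt v) :
    ∃ ψ : FramedGaloisRep ℚ (PadicAlgCl p) 4,
      (∀ τ : absoluteGaloisGroup ℚ, τ ∉ Set.range (absGaloisRestrict ℚ F) →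
        ∀ σ σ' : absoluteGaloisGroup F,
          absGaloisRestrict ℚ F σ' = τ * absGaloisRestrict ℚ F σ * τ⁻¹ →
            (ψ (absGaloisRestrict ℚ F σ)).val.trace = (ρ σ).val.trace * (ρ σ').val.trace) ∧
      (∃ (τ₀ : absoluteGaloisGroup ℚ) (_ : τ₀ ∉ Set.range (absGaloisRestrict ℚ F))
          (e : Fin 2 × Fin 2 ≃ Fin 4) (P : GL (Fin 4) (PadicAlgCl p)),
        ∀ σ : absoluteGaloisGroup F,
          (ψ (absGaloisRestrict ℚ F σ)).val =
            P.val * Matrix.reindex e e ((ρ σ).val ⊗ₖ (ρ (absGaloisOuterConj ℚ F τ₀ σ)).val) *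
              P⁻¹.val) ∧
      (∀ᶠ v : HeightOneSpectrum (𝓞 ℚ) in Filter.cofinite, ψ.IsUnramifiedAt v) ∧
      (∃ (J : Matrix (Fin 4) (Fin 4) (PadicAlgCl p)) (μ : absoluteGaloisGroup ℚ →* (PadicAlgCl p)ˣ),
        J.IsSymm ∧ IsUnit J.det ∧
          (∀ g : absoluteGaloisGroup ℚ,
            (ψ g).val.transpose * J * (ψ g).val = (μ g : PadicAlgCl p) • J) ∧
          ∀ (φ : ℚ →+* ℝ) (c : absoluteGaloisGroup ℚ), IsComplexConjugation φ c → μ c = 1) ∧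
      (∀ (φ : ℚ →+* ℝ) (c : absoluteGaloisGroup ℚ), IsComplexConjugation φ c →
        (ψ c).val.trace ≠ 0) := by
  have h2 : Module.finrank ℚ F = 2 := Algebra.IsQuadraticExtension.finrank_eq_two ℚ F
  let e : Fin 2 × Fin 2 ≃ Fin 4 := finProdFinEquiv
  refine ⟨tensorInduce ℚ F h2 e ρ, ?_, ?_, ?_, ?_, ?_⟩
  · intro τ hτ σ σ' hσ'
    exact trace_tensorInduce_absGaloisRestrict_eq ℚ F h2 e ρ (fun ⟨x, hx⟩ => hτ ⟨x, hx⟩) σ σ' hσ'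
  · exact ⟨tiTau ℚ F h2, fun ⟨x, hx⟩ => tiTau_not_mem ℚ F h2 ⟨x, hx⟩, e, 1,
      fun σ => tensorInduce_absGaloisRestrict_val_eq_kronecker F h2 p e ρ σ⟩
  · exact eventually_isUnramifiedAt_tensorInduce ℚ F h2 e ρ hunr
  · refine ⟨tiForm e, (tiMult ℚ F h2 ρ).toHomUnits, tiForm_isSymm e, isUnit_det_tiForm e,
      fun g => tensorInduce_transpose_mul_tiForm_mul ℚ F h2 e ρ g, fun φ c hc => ?_⟩
    obtain ⟨hc1, hc2⟩ := not_mem_range_and_mul_self_of_isComplexConjugation F hF hc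
    exact Units.ext (tiMult_of_not_mem_of_mul_self ℚ F h2 ρ hc1 hc2)
  · intro φ c hc
    obtain ⟨hc1, hc2⟩ := not_mem_range_and_mul_self_of_isComplexConjugation F hF hc
    change FramedRep.trace (tensorInduce ℚ F h2 e ρ) c ≠ 0
    rw [trace_tensorInduce_of_not_mem_of_mul_self ℚ F h2 e ρ hc1 hc2]
    exact Nat.cast_ne_zero.2 two_ne_zero

end Rat

/-! ### The registered stub: (T0), (T0'), (T1), (T2), (T5) over `ℚ` -/

section Stub

/-- **Registered stub `stub_tensorInductionExists` of line `merged` (v2), crux `TensorSquareParallel`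
(stmt-Langlands-17009)**: for `F/ℚ` imaginary quadratic and `ρ : Γ_F →ₜ* GL₂(ℚ̄_p)` unramified almost
everywhere there is `ψ : Γ_ℚ →ₜ* GL₄(ℚ̄_p)` (namely `⊗-Ind_{Γ_F}^{Γ_ℚ} ρ`) with (T0) the trace identity
on `Γ_F`, (T0') `ψ|_{Γ_F}` equal to the relabelled Kronecker product `ρ ⊗ₖ ρ^{θ_{τ₀}}` up to a frame
change, (T1) unramified a.e., (T2) `GO₄`-valued with trivial multiplier at complex conjugations, and
(T5) `tr ψ(c) ≠ 0` (`exists_tensorInduction_kronecker`).  Ref: F. Calegari, *Even Galois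
representations and the Fontaine–Mazur conjecture*, §2. [folklore] -/
theorem stub_tensorInductionExists :
    ∀ (F : Type) [Field F] [NumberField F] [Algebra.IsQuadraticExtension ℚ F], NumberField.IsTotallyComplex F → ∀ (p : ℕ) [Fact p.Prime] (ρ : FramedGaloisRep F (PadicAlgCl p) 2), (∀ᶠ v : HeightOneSpectrum (𝓞 F) in Filter.cofinite, ρ.IsUnramifiedAt v) → ∃ ψ : FramedGaloisRep ℚ (PadicAlgCl p) 4, (∀ τ : absoluteGaloisGroup ℚ, τ ∉ Set.range (absGaloisRestrict ℚ F) → ∀ σ σ' : absoluteGaloisGroup F, absGaloisRestrict ℚ F σ' = τ * absGaloisRestrict ℚ F σ * τ⁻¹ → (ψ (absGaloisRestrict ℚ F σ)).val.trace = (ρ σ).val.trace * (ρ σ').val.trace) ∧ (∃ (τ₀ : absoluteGaloisGroup ℚ) (_ : τ₀ ∉ Set.range (absGaloisRestrict ℚ F)) (e : Fin 2 × Fin 2 ≃ Fin 4) (P : GL (Fin 4) (PadicAlgCl p)), ∀ σ : absoluteGaloisGroup F, (ψ (absGaloisRestrict ℚ F σ)).val = P.val * Matrix.reindex e e ((ρ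 σ).val ⊗ₖ (ρ (absGaloisOuterConj ℚ F τ₀ σ)).val) * P⁻¹.val) ∧ (∀ᶠ v : HeightOneSpectrum (𝓞 ℚ) in Filter.cofinite, ψ.IsUnramifiedAt v) ∧ (∃ (J : Matrix (Fin 4) (Fin 4) (PadicAlgCl p)) (μ : absoluteGaloisGroup ℚ →* (PadicAlgCl p)ˣ), J.IsSymm ∧ IsUnit J.det ∧ (∀ g : absoluteGaloisGroup ℚ, (ψ g).val.transpose * J * (ψ g).val = (μ g : PadicAlgCl p) • J) ∧ ∀ (φ : ℚ →+* ℝ) (c : absoluteGaloisGroup ℚ), IsComplexConjugation φ c → μ c = 1) ∧ (∀ (φ : ℚ →+* ℝ) (c : absoluteGaloisGroup ℚ), IsComplexConjugation φ c → (ψ c).val.trace ≠ 0) :=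
  fun F _ _ _ hF p _ ρ hunr => exists_tensorInduction_kronecker F hF p ρ hunr

end Stub

end Summit.Langlands.Langlands.Theorems.TensorSquareParallel

end
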